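import Summits.QuantumFields.YangMills.Theorems.BalabanUVNodesN15VectorPieceVWords
import Summits.QuantumFields.YangMills.Theorems.BalabanUVNodesN15ContourProducts
import HarnessLib

/-!
# Route «BalabanUVNodes» (K4 «SpineRates»), node N15 = NE2 — THE ONE-LEVEL PARALLEL-TRANSPORT SPECIES AND ITS SIX LETTERS: `F₂(A′) = Q∘M_{K(A′)}`,
# `F₂*(A′) = M_{K(A′)}∘Q*` with the kernel `K(A′)(x) = Π_{b ∈ Γ_{B(x),x}} exp(η·ad A′(b)) − 1` — the print's `R((U′U)(Γ_{y,x}))(R(U(Γ_{y,x})))⁻¹ − 1` of (3.57)–(3.58) at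
# `U ≡ 1` on the one-level staircase contour, NOT linearised — sup letters from `‖Π − 1‖ ≤ e^{Σ‖X‖} − 1`, fit letters from the factorwise two-spacing comparison of
# `…N15ContourProducts`; hence `NE2PlusOperator` BY NAME for the vector piece dressed by the full (3.60) perturbation with THIS species

Cell `pub-ymgap`, seat `pub-ymgap-dag-n15-c` (generation g4; R134 ACCELERATION SEAT, strategy s1 «first missing estimate»; HUMAN RULING D-0062; chair R424 venue;
`bears_on: R4∕N15`).  Filed `--supports stmt-QuantumFields-19908 --as helper` (K3′; helper).  Imports BY NAME, nothing in the tree modified: this seat's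
`…N15VectorPieceVWords` (**`ne2PlusOperator_vectorPiece_vWordsG`**, `qbond`, `card_fibre_kingPrV_lift`, `vWGVecFamily4`; through it (V5) `fibAvg`, `hasMaj_fibAvg_comp`,
`hasMaj_idef_fibAvg_comp`, (V4) `fibre_conn_kingPrV`, `reg335_v1GVec_iff`, G1 `gavgM`, n15-b `fit_blockAvgV`∕`norm_blockAvgV_le`∕`mmulOp`∕`hasMaj_mmulOp`∕`coordMat`∕
`basisConst`∕`rowBound_of_opNormBound`∕`hasMaj_idef_mmulOp_of_opNormFit`∕`norm_adCLM_le_of_le`∕`norm_adCLM_sub_le`, `adCLM`) and `…N15ContourProducts` (`lineProd`,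
`norm_lineProd_sub_one_le`, **`norm_stairProd_two_spacing_le`**).

THE POINT.  `…N15VectorPieceVWordsLinear` discharged the six species letters for the FIRST-ORDER kernel `ad(ηΣ_Γ A′)`.  THIS FILE does it for the parallel
transport itself at `U ≡ 1`: [Balaban1985BackgroundPropagators] (3.57) p. 401 writes the averaging perturbation through `(U′U)(Γ^{(j)}_{y,x})(U(Γ^{(j)}_{y,x}))⁻¹ − 1`
(p. 401: «|(U′U)(Γ^{(j)}_{y,x})(U(Γ^{(j)}_{y,x}))⁻¹ − 1| < O(1)α₁»); at `U ≡ 1`, in the adjoint representation on `𝔄`, this is `K(A′)(x) = Π_{b∈Γ_{B(x),x}} exp(η·ad A′(b)) − 1`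
— the ORDERED product along the staircase (`…N15ContourProducts.lineProd`).  Coarse side: factors `exp(η·ad Ā(b)) = exp(L^m•(η′·ad Ā(b)))`, `Ā` the fibrewise mean;
fine side: `exp(η′·ad A′(b′))`.  THE LETTERS (`expF_letters`), in the smallness regime `2c₃₅Mα₀ ≤ 1` (so `ρ·n = 2c₃₅Mα₀·(η n) ≤ 1` per level): sup —
`‖K‖ ≤ e^{2(d+1)c₃₅Mα₀} − 1 ≤ 2(d+1)e^{d+1}·c₃₅Mα₀`; fit — `norm_lineProd_two_spacing_le` with `ω = 2η′·(fibre oscillation) ≤ 2η′·C_π c₃₅Mα₀η′` and `L^mρ = 2η·c₃₅Mα₀`: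
`‖K′(x′) − K(pr x′)‖ ≤ 3^{d+1}(d+1)(144(d+1) + 18)·c₃₅Mα₀·θ_j`; both moved through `Q` by (V5) §5.  So `c_F = 3^{d+1}(d+1)(144(d+1)+18)·κ_e` and
**`ne2PlusOperator_vectorPiece_vWordsExp`** — every species letter a theorem, no linearisation of the transport.

CONTENTS.  §1 `norm_lineProd_two_spacing_le` (the `lineProd` form of `…ContourProducts.norm_stairProd_two_spacing_le`), `expCF` (`expCF_nonneg_le`), `expXf`∕`expXc` (the exponent fields), `expKerC`∕`expKerF`, `expFc`∕`expFsc`∕`expFf`∕`expFsf`; **`expF_letters`**.  §2 **`ne2PlusOperator_vectorPiece_vWordsExp`**, `_dim4`,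
`ne2ZeroOperator_vectorPiece_vWordsExp`.

HONEST FRAMING ∕ LIMITS.  `U ≡ 1`: no `U(b)` factors and no rotations `R(·)` (the print's product `R((U′U)(Γ))(R(U(Γ)))⁻¹` collapses to `Π exp(η ad A′)`); ONE-LEVEL
staircase contour from the block corner (NOT the multi-level contour of (3.55), which lives on NODE 00's carriers); the starred kernel is taken equal to the unstarred
one (orientation immaterial for the letters); the one-spacing bound (3.58) for the print's object is the Literature cell's `B9Eq358KeyEstimate` (another carrier), not
consumed; `Q` = plain unit-block mean componentwise; (3.35) = OUR unit-scale C² letters; transport of configurations = fibrewise mean (linearised (C3)); LINEAR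
(U = 1) vector piece; crude constants.  NE2⁺ NOT PRINTED; count-neutral (typed 28∕28 · discharged unchanged); NOT a discharge of N15; one finite T⁴ at fixed ε —
NOT infinite volume, NOT OS on ℝ⁴, NOT a mass gap, NOT Clay.
-/

noncomputable section

open scoped BigOperators
open Finset NormedSpace

namespace Summit.QuantumFields.YangMills.BalabanUVNodes.N15.VectorPiece

open Literature.MathematicalPhysics.QuantumFieldTheory.Balaban1983to89
open Literature.MathematicalPhysics.QuantumFieldTheory.Balaban1983to89.B11SectG (BlockNorm HasMaj)
open Literature.MathematicalPhysics.QuantumFieldTheory.Balaban1983to89.T4EtaRate (PairedInstance NE2PlusOperator NE2ZeroOperator ne2Zero_of_ne2Plus)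
open Literature.MathematicalPhysics.QuantumFieldTheory.Balaban1983to89.T4EtaRateDefect (idef)
open Literature.MathematicalPhysics.QuantumFieldTheory.Balaban1983to89.T4EtaRateCoeffDefect (pull diagK diagK_mono)
open Literature.MathematicalPhysics.QuantumFieldTheory.Balaban1983to89.B5Prop11Plancherel (Tor fine unitVec)
open Literature.MathematicalPhysics.QuantumFieldTheory.Balaban1983to89.B5Block118 (bpt)
open Literature.MathematicalPhysics.QuantumFieldTheory.Balaban1983to89.B7Prop6Bound (oprod)
open Literature.MathematicalPhysics.QuantumFieldTheory.Balaban1983to89.B5Blocks16 (bpt_bijective)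
open Literature.MathematicalPhysics.QuantumFieldTheory.Balaban1983to89.Beta.AveragingCorrectionJets (adCLM)
open Summit.QuantumFields.YangMills.BalabanUVNodes.N15.MatrixSpecies (liftMap liftBlk coordMat basisConst basisConst_nonneg mmulOp hasMaj_mmulOp
  rowBound_of_opNormBound hasMaj_idef_mmulOp_of_opNormFit norm_adCLM_le_of_le norm_adCLM_sub_le blockAvgV fit_blockAvgV norm_blockAvgV_le)
open Summit.QuantumFields.YangMills.BalabanUVNodes.N15.BackgroundLayer (gavgM fibAvg hasMaj_fibAvg_comp hasMaj_idef_fibAvg_comp)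

variable {d : ℕ}

/-! ## §1 The parallel-transport species and its six letters -/

section LineProdPair

variable {𝔸 : Type} [NormedRing 𝔸] [NormedAlgebra ℝ 𝔸] [CompleteSpace 𝔸]
variable (L k m : ℕ) [NeZero L] (M : Fin (d + 1) → ℕ) [∀ μ, NeZero (M μ)]

/-- **THE SAME AT A FINE CARRIER POINT**: `‖lineProd′ X′ p′ − lineProd (L^m•X̃) (pr p′)‖ ≤ 3^{d+1}(d+1)·(36·L^mL^k·ω + 9·L^m·ρ)`. [cite: Balaban1985BackgroundPropagators, (3.57)–(3.58) pp.401–402 (shape); King1986, p.664] -/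
theorem norm_lineProd_two_spacing_le {X' : Fin (d + 1) → Tor (fine (L ^ m * L ^ k) M) × Fin (d + 1) → 𝔸}
    {Xt : Fin (d + 1) → Tor (fine (L ^ k) M) × Fin (d + 1) → 𝔸} {ρ ω : ℝ} (hρ : 0 ≤ ρ) (hω : 0 ≤ ω) (hρn : ρ * ((L ^ m * L ^ k : ℕ) : ℝ) ≤ 1)
    (hX' : ∀ μ b, ‖X' μ b‖ ≤ ρ) (hXt : ∀ μ b, ‖Xt μ b‖ ≤ ρ) (hfit : ∀ μ b', ‖X' μ b' - Xt μ (kingPrV L k m M b')‖ ≤ ω)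
    (p' : Tor (fine (L ^ m * L ^ k) M) × Fin (d + 1)) :
    ‖lineProd (L ^ m * L ^ k) M X' p' - lineProd (L ^ k) M (fun μ b => ((L ^ m : ℕ) : ℝ) • Xt μ b) (kingPrV L k m M p')‖ ≤
      3 ^ (d + 1) * ((d + 1) * (36 * ((L ^ m * L ^ k : ℕ) : ℝ) * ω + 9 * (((L ^ m : ℕ) : ℝ) * ρ))) := by
  obtain ⟨⟨y, a'⟩, hx⟩ := (bpt_bijective (L ^ m * L ^ k) M).2 p'.1
  simp only at hx
  have hp : p' = (bpt (L ^ m * L ^ k) M y a', p'.2) := Prod.ext hx.symm rfl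
  rw [hp, kingPrV_eq, kingPr_bpt_hdig, lineProd_bpt, lineProd_bpt]
  exact norm_stairProd_two_spacing_le L k m M hρ hω hρn hX' hXt hfit y a' p'.2

end LineProdPair

section Species

variable {𝔄 : Type} [NormedRing 𝔄] [NormedAlgebra ℝ 𝔄] [CompleteSpace 𝔄] (ι : Type) [Fintype ι] [DecidableEq ι] (e : 𝔄 ≃L[ℝ] (ι → ℝ)) (L : ℕ) [NeZero L]

/-- THE SPECIES CONSTANT `c_F = 3^{d+1}(d+1)(144(d+1) + 18)·κ`. [folklore] -/
def expCF (d : ℕ) (κ : ℝ) : ℝ := 3 ^ (d + 1) * ((d : ℝ) + 1) * (144 * ((d : ℝ) + 1) + 18) * κ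

omit [NeZero L] in
/-- `0 ≤ c_F` and `2(d+1)e^{d+1}κ ≤ c_F` for `κ ≥ 0` (`e ≤ 3`). [folklore] -/
theorem expCF_nonneg_le {κ : ℝ} (hκ : 0 ≤ κ) : 0 ≤ expCF d κ ∧ 2 * ((d : ℝ) + 1) * Real.exp ((d : ℝ) + 1) * κ ≤ expCF d κ := by
  have hd : (0 : ℝ) ≤ (d : ℝ) + 1 := by positivity
  have he3 : Real.exp ((d : ℝ) + 1) ≤ 3 ^ (d + 1) := by
    rw [show ((d : ℝ) + 1) = ((d + 1 : ℕ) : ℝ) * 1 by push_cast; ring, Real.exp_nat_mul]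
    exact pow_le_pow_left₀ (Real.exp_nonneg _) (by have := Real.exp_one_lt_d9; linarith) _
  unfold expCF
  refine ⟨by positivity, ?_⟩
  have h3 : (0 : ℝ) ≤ 3 ^ (d + 1) := by positivity
  nlinarith [mul_nonneg hd hκ, mul_le_mul_of_nonneg_right he3 (mul_nonneg hd hκ), mul_nonneg h3 (mul_nonneg hd hκ)]

/-- THE FINE-STEP EXPONENT FIELD of the fine gauge field: `X′_μ(b′) = η′·ad A′_μ(b′)`, `η′ = L^{−k}L^{−m}`. [cite: Balaban1985BackgroundPropagators, (3.57) p.401 («U′ = e^{iξA′}»: shape)] -/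
def expXf (j : VecIndexS d L) (A' : Fin (d + 1) → Tor (fine (L ^ j.m * L ^ j.k) j.Mn) × Fin (d + 1) → 𝔄) :
    Fin (d + 1) → Tor (fine (L ^ j.m * L ^ j.k) j.Mn) × Fin (d + 1) → (𝔄 →L[ℝ] 𝔄) :=
  fun μ b' => (((L : ℝ) ^ j.k)⁻¹ * ((L : ℝ) ^ j.m)⁻¹) • adCLM ℝ (A' μ b')

/-- THE FINE-STEP EXPONENT FIELD of the coarse (fibrewise-mean) gauge field: `X̃_μ(b) = η′·ad Ā_μ(b)` (the coarse factor is `exp(L^m•X̃(b)) = exp(η·ad Ā(b))`).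
[cite: Balaban1985BackgroundPropagators, (3.57) p.401 (shape)] -/
def expXc (j : VecIndexS d L) (A' : Fin (d + 1) → Tor (fine (L ^ j.m * L ^ j.k) j.Mn) × Fin (d + 1) → 𝔄) :
    Fin (d + 1) → Tor (fine (L ^ j.k) j.Mn) × Fin (d + 1) → (𝔄 →L[ℝ] 𝔄) :=
  fun μ b => (((L : ℝ) ^ j.k)⁻¹ * ((L : ℝ) ^ j.m)⁻¹) • adCLM ℝ (gavgM 𝔄 (Fin (d + 1)) (kingPrV L j.k j.m j.Mn) A' μ b)

/-- THE COARSE KERNEL at index `j` for the gauge field `A′`: `K(x) = Π_{b∈Γ_{B(x),x}} exp(η·ad Ā(b)) − 1`, `η = L^{−k} = L^m·η′`, `Ā` the fibrewise mean of `A′` (each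
factor written `exp(L^m•X̃(b))`). [cite: Balaban1985BackgroundPropagators, (3.57)–(3.58) pp.401–402 («(U′U)(Γ_{y,x})(U(Γ_{y,x}))⁻¹ − 1»: shape at U ≡ 1)] -/
def expKerC (j : VecIndexS d L) (A' : Fin (d + 1) → Tor (fine (L ^ j.m * L ^ j.k) j.Mn) × Fin (d + 1) → 𝔄)
    (p : Tor (fine (L ^ j.k) j.Mn) × Fin (d + 1)) : 𝔄 →L[ℝ] 𝔄 :=
  lineProd (L ^ j.k) j.Mn (fun μ b => ((L ^ j.m : ℕ) : ℝ) • expXc L j A' μ b) p - 1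

/-- THE FINE KERNEL: `K′(x′) = Π_{b′∈Γ′_{B(x′),x′}} exp(η′·ad A′(b′)) − 1`. [cite: Balaban1985BackgroundPropagators, (3.57)–(3.58) pp.401–402 (shape at U ≡ 1)] -/
def expKerF (j : VecIndexS d L) (A' : Fin (d + 1) → Tor (fine (L ^ j.m * L ^ j.k) j.Mn) × Fin (d + 1) → 𝔄)
    (p' : Tor (fine (L ^ j.m * L ^ j.k) j.Mn) × Fin (d + 1)) : 𝔄 →L[ℝ] 𝔄 :=
  lineProd (L ^ j.m * L ^ j.k) j.Mn (expXf L j A') p' - 1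

/-- THE COARSE SPECIES `F₂(A′) = Q∘M_{K(A′)}` (coordinates `e`). [cite: Balaban1985BackgroundPropagators, (3.58)–(3.59) p.402 (shape)] -/
def expFc (j : VecIndexS d L) (A' : Fin (d + 1) → Tor (fine (L ^ j.m * L ^ j.k) j.Mn) × Fin (d + 1) → 𝔄) :
    ((Tor (fine (L ^ j.k) j.Mn) × Fin (d + 1)) × ι → ℝ) →ₗ[ℝ] ((Tor j.Mn × Fin (d + 1)) × ι → ℝ) :=
  fibAvg (liftMap (qbond L j.k j.Mn) ι) ∘ₗ mmulOp fun p => coordMat e (expKerC L j A' p)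

/-- THE COARSE STARRED SPECIES `F₂*(A′) = M_{K(A′)}∘Q*`. [cite: Balaban1985BackgroundPropagators, (3.60) p.402 (shape)] -/
def expFsc (j : VecIndexS d L) (A' : Fin (d + 1) → Tor (fine (L ^ j.m * L ^ j.k) j.Mn) × Fin (d + 1) → 𝔄) :
    ((Tor j.Mn × Fin (d + 1)) × ι → ℝ) →ₗ[ℝ] ((Tor (fine (L ^ j.k) j.Mn) × Fin (d + 1)) × ι → ℝ) :=
  (mmulOp fun p => coordMat e (expKerC L j A' p)) ∘ₗ pull (liftMap (qbond L j.k j.Mn) ι)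

/-- THE FINE SPECIES `F₂′(A′) = Q′∘M_{K′(A′)}`. [cite: Balaban1985BackgroundPropagators, (3.58)–(3.59) p.402 (shape)] -/
def expFf (j : VecIndexS d L) (A' : Fin (d + 1) → Tor (fine (L ^ j.m * L ^ j.k) j.Mn) × Fin (d + 1) → 𝔄) :
    ((Tor (fine (L ^ j.m * L ^ j.k) j.Mn) × Fin (d + 1)) × ι → ℝ) →ₗ[ℝ] ((Tor j.Mn × Fin (d + 1)) × ι → ℝ) :=
  fibAvg (liftMap (qbond L j.k j.Mn) ι ∘ liftMap (kingPrV L j.k j.m j.Mn) ι) ∘ₗ mmulOp fun p' => coordMat e (expKerF L j A' p')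

/-- THE FINE STARRED SPECIES `F₂*′(A′) = M_{K′(A′)}∘Q′*`. [cite: Balaban1985BackgroundPropagators, (3.60) p.402 (shape)] -/
def expFsf (j : VecIndexS d L) (A' : Fin (d + 1) → Tor (fine (L ^ j.m * L ^ j.k) j.Mn) × Fin (d + 1) → 𝔄) :
    ((Tor j.Mn × Fin (d + 1)) × ι → ℝ) →ₗ[ℝ] ((Tor (fine (L ^ j.m * L ^ j.k) j.Mn) × Fin (d + 1)) × ι → ℝ) :=
  (mmulOp fun p' => coordMat e (expKerF L j A' p')) ∘ₗ pull (liftMap (qbond L j.k j.Mn) ι ∘ liftMap (kingPrV L j.k j.m j.Mn) ι)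

variable {ι L}

/-- **THE SIX LETTERS OF THE PARALLEL-TRANSPORT SPECIES.**  `L ≥ 1`; at index `j`, `c₃₅ > 0`, `α₀ > 0` in the smallness regime `2c₃₅Mα₀ ≤ 1`, a gauge field `A′`
regular in the sense of the realised gauge carrier: with `c_F = 3^{d+1}(d+1)(144(d+1)+18)κ_e` the sup letters `≤ diagK (c_F·c₃₅Mα₀)` of `F₂, F₂*, F₂′, F₂*′` and the
fit letters `𝔇(F₂′, F₂), 𝔇(F₂*′, F₂*) ≤ diagK (c_F·c₃₅Mα₀·θ_j)`. [cite: Balaban1985BackgroundPropagators, (3.57)–(3.59) pp.401–402 (shapes); (3.35) p.396; King1986, p.664] -/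
theorem expF_letters (hL : 1 ≤ L) (j : VecIndexS d L) {c35 α₀ : ℝ} (hc35 : 0 < c35) (hα₀ : 0 < α₀) (hsm : 2 * (c35 * (j.Msz * α₀)) ≤ 1)
    {A' : Fin (d + 1) → Tor (fine (L ^ j.m * L ^ j.k) j.Mn) × Fin (d + 1) → 𝔄} (hreg : (v1GVecInstance (d := d) 𝔄 ι L hL j).Bf.Reg335 c35 α₀ A') :
    HasMaj (BlockNorm.ofBlocks (unitTorusGeoS L j.k j.Mn j.Msz) (liftBlk (blkFine L j.k j.Mn) ι))
        (BlockNorm.ofBlocks (unitTorusGeoS L j.k j.Mn j.Msz) (liftBlk (fun b : Tor j.Mn × Fin (d + 1) => b.1) ι)) (expFc ι e L j A')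
        (diagK fun _ => expCF d (basisConst e) * (c35 * j.Msz * α₀)) ∧
      HasMaj (BlockNorm.ofBlocks (unitTorusGeoS L j.k j.Mn j.Msz) (liftBlk (fun b : Tor j.Mn × Fin (d + 1) => b.1) ι))
        (BlockNorm.ofBlocks (unitTorusGeoS L j.k j.Mn j.Msz) (liftBlk (blkFine L j.k j.Mn) ι)) (expFsc ι e L j A')
        (diagK fun _ => expCF d (basisConst e) * (c35 * j.Msz * α₀)) ∧
      HasMaj (BlockNorm.ofBlocks (unitTorusGeoS L j.k j.Mn j.Msz) (liftBlk (blkFine L j.k j.Mn ∘ kingPrV L j.k j.m j.Mn) ι))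
        (BlockNorm.ofBlocks (unitTorusGeoS L j.k j.Mn j.Msz) (liftBlk (fun b : Tor j.Mn × Fin (d + 1) => b.1) ι)) (expFf ι e L j A')
        (diagK fun _ => expCF d (basisConst e) * (c35 * j.Msz * α₀)) ∧
      HasMaj (BlockNorm.ofBlocks (unitTorusGeoS L j.k j.Mn j.Msz) (liftBlk (fun b : Tor j.Mn × Fin (d + 1) => b.1) ι))
        (BlockNorm.ofBlocks (unitTorusGeoS L j.k j.Mn j.Msz) (liftBlk (blkFine L j.k j.Mn ∘ kingPrV L j.k j.m j.Mn) ι)) (expFsf ι e L j A')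
        (diagK fun _ => expCF d (basisConst e) * (c35 * j.Msz * α₀)) ∧
      HasMaj (BlockNorm.ofBlocks (unitTorusGeoS L j.k j.Mn j.Msz) (liftBlk (blkFine L j.k j.Mn) ι))
        (BlockNorm.ofBlocks (unitTorusGeoS L j.k j.Mn j.Msz) (liftBlk (fun b : Tor j.Mn × Fin (d + 1) => b.1) ι))
        (idef (pull (liftMap (kingPrV L j.k j.m j.Mn) ι)) LinearMap.id (expFf ι e L j A') (expFc ι e L j A'))
        (diagK fun _ => expCF d (basisConst e) * (c35 * j.Msz * α₀) * thetaV L j) ∧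
      HasMaj (BlockNorm.ofBlocks (unitTorusGeoS L j.k j.Mn j.Msz) (liftBlk (fun b : Tor j.Mn × Fin (d + 1) => b.1) ι))
        (BlockNorm.ofBlocks (unitTorusGeoS L j.k j.Mn j.Msz) (liftBlk (blkFine L j.k j.Mn ∘ kingPrV L j.k j.m j.Mn) ι))
        (idef LinearMap.id (pull (liftMap (kingPrV L j.k j.m j.Mn) ι)) (expFsf ι e L j A') (expFsc ι e L j A'))
        (diagK fun _ => expCF d (basisConst e) * (c35 * j.Msz * α₀) * thetaV L j) := by
  obtain ⟨h1, h2, -⟩ := (reg335_v1GVec_iff (d := d) 𝔄 ι L hL j c35 α₀ A').1 hreg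
  -- constants
  set r : ℝ := c35 * j.Msz * α₀ with hr_def
  have hM0 : 0 ≤ j.Msz := zero_le_one.trans j.one_le_Msz
  have hr0 : 0 ≤ r := by positivity
  have hr2 : 2 * r ≤ 1 := by rw [hr_def, show c35 * j.Msz * α₀ = c35 * (j.Msz * α₀) by ring]; exact hsm
  have hL0 : L ≠ 0 := by omega
  have hLr : (0 : ℝ) < (L : ℝ) := by exact_mod_cast (show 0 < L by omega)
  have hLk : (0 : ℝ) < (L : ℝ) ^ j.k := pow_pos hLr _
  have hLm : (0 : ℝ) < (L : ℝ) ^ j.m := pow_pos hLr _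
  set ηc : ℝ := ((L : ℝ) ^ j.k)⁻¹ with hηc
  set ηf : ℝ := ((L : ℝ) ^ j.k)⁻¹ * ((L : ℝ) ^ j.m)⁻¹ with hηf
  have hηc0 : 0 ≤ ηc := inv_nonneg.2 hLk.le
  have hηf0 : 0 ≤ ηf := mul_nonneg hηc0 (inv_nonneg.2 hLm.le)
  have hηcf : ηc = ((L ^ j.m : ℕ) : ℝ) * ηf := by rw [hηf, hηc]; push_cast; field_simp
  have hθ0 : 0 ≤ thetaV L j := by unfold thetaV; positivity
  have hηθ : ηc ≤ thetaV L j := inv_pow_le_rpow hL j.k (by norm_num)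
  have hd0 : (0 : ℝ) ≤ (d : ℝ) + 1 := by positivity
  have hd1 : (0 : ℝ) ≤ 2 * ((d : ℝ) + 1) := by positivity
  have hκ : 0 ≤ basisConst e := basisConst_nonneg e
  obtain ⟨hcF0, hcF1⟩ := expCF_nonneg_le (d := d) hκ
  have hnk : ((L ^ j.k : ℕ) : ℝ) * ηc = 1 := by rw [hηc]; push_cast; field_simp
  have hnf : ((L ^ j.m * L ^ j.k : ℕ) : ℝ) * ηf = 1 := by rw [hηf]; push_cast; field_simp
  -- `C_π η′ ≤ 2(d+1) θ_j`
  set Cπ : ℝ := ((2 * ((d + 1) * (L ^ j.m - 1)) : ℕ) : ℝ) with hCπ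
  have hCπ0 : 0 ≤ Cπ := Nat.cast_nonneg _
  have hCθ : Cπ * ηf ≤ 2 * ((d : ℝ) + 1) * thetaV L j := by
    have hsub : (((L ^ j.m - 1 : ℕ)) : ℝ) ≤ (L : ℝ) ^ j.m := by
      have h1' : 1 ≤ L ^ j.m := Nat.one_le_pow _ _ (by omega)
      rw [Nat.cast_sub h1']; push_cast; linarith
    have hcast : Cπ = 2 * ((d : ℝ) + 1) * (((L ^ j.m - 1 : ℕ)) : ℝ) := by rw [hCπ]; push_cast; ring
    rw [hcast, hηf]
    calc 2 * ((d : ℝ) + 1) * (((L ^ j.m - 1 : ℕ)) : ℝ) * (((L : ℝ) ^ j.k)⁻¹ * ((L : ℝ) ^ j.m)⁻¹)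
        ≤ 2 * ((d : ℝ) + 1) * (L : ℝ) ^ j.m * (((L : ℝ) ^ j.k)⁻¹ * ((L : ℝ) ^ j.m)⁻¹) :=
          mul_le_mul_of_nonneg_right (mul_le_mul_of_nonneg_left hsub hd1) (by positivity)
      _ = 2 * ((d : ℝ) + 1) * ((L : ℝ) ^ j.k)⁻¹ := by field_simp
      _ ≤ 2 * ((d : ℝ) + 1) * thetaV L j := mul_le_mul_of_nonneg_left hηθ hd1
  -- the fields: sizes and the pointwise fit of `A′` to its fibrewise mean
  set Abar := gavgM 𝔄 (Fin (d + 1)) (kingPrV L j.k j.m j.Mn) A' with hAbar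
  have hA' : ∀ μ b, ‖A' μ b‖ ≤ r := h1
  have hAbar_le : ∀ μ b, ‖Abar μ b‖ ≤ r := fun μ b => norm_blockAvgV_le (kingPrV L j.k j.m j.Mn) hr0 (h1 μ) b
  have hosc : ∀ μ x₁ x₂, kingPrV L j.k j.m j.Mn x₁ = kingPrV L j.k j.m j.Mn x₂ → ‖A' μ x₁ - A' μ x₂‖ ≤ Cπ * (r * ηf) := fun μ =>
    fibre_conn_kingPrV L j.k j.m j.Mn (A' μ) (r * ηf) fun κ i => by
      have := h2 μ κ i
      simpa [bshiftEquiv_apply, hr_def, hηf] using this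
  have hfitA : ∀ μ b', ‖A' μ b' - Abar μ (kingPrV L j.k j.m j.Mn b')‖ ≤ Cπ * (r * ηf) := fun μ b' =>
    fit_blockAvgV (kingPrV L j.k j.m j.Mn) (Ω := fun _ => Cπ * (r * ηf)) (fun x₁ x₂ h => hosc μ x₁ x₂ h) b'
  -- the exponent fields `X′ = η′·ad A′`, `X̃ = η′·ad Ā` and their letters: `ρ = 2η′r`, `ω = 2η′·C_π r η′`
  have hX'le : ∀ μ b', ‖expXf L j A' μ b'‖ ≤ ηf * (2 * r) := fun μ b' => by
    unfold expXf
    rw [← hηf, norm_smul, Real.norm_eq_abs, abs_of_nonneg hηf0]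
    exact mul_le_mul_of_nonneg_left (norm_adCLM_le_of_le (hA' μ b')) hηf0
  have hXtle : ∀ μ b, ‖expXc L j A' μ b‖ ≤ ηf * (2 * r) := fun μ b => by
    unfold expXc
    rw [← hηf, ← hAbar, norm_smul, Real.norm_eq_abs, abs_of_nonneg hηf0]
    exact mul_le_mul_of_nonneg_left (norm_adCLM_le_of_le (hAbar_le μ b)) hηf0
  have hXfit : ∀ μ b', ‖expXf L j A' μ b' - expXc L j A' μ (kingPrV L j.k j.m j.Mn b')‖ ≤ ηf * (2 * (Cπ * (r * ηf))) := fun μ b' => by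
    unfold expXf expXc
    rw [← hηf, ← hAbar, (smul_sub ηf (adCLM ℝ (A' μ b')) (adCLM ℝ (Abar μ (kingPrV L j.k j.m j.Mn b')))).symm, norm_smul, Real.norm_eq_abs,
      abs_of_nonneg hηf0]
    exact mul_le_mul_of_nonneg_left ((norm_adCLM_sub_le _ _).trans (mul_le_mul_of_nonneg_left (hfitA μ b') zero_le_two)) hηf0
  have hρ0 : 0 ≤ ηf * (2 * r) := by positivity
  have hρn : ηf * (2 * r) * ((L ^ j.m * L ^ j.k : ℕ) : ℝ) ≤ 1 := by
    calc ηf * (2 * r) * ((L ^ j.m * L ^ j.k : ℕ) : ℝ) = (((L ^ j.m * L ^ j.k : ℕ) : ℝ) * ηf) * (2 * r) := by ring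
      _ = 2 * r := by rw [hnf, one_mul]
      _ ≤ 1 := hr2
  -- the kernels: sizes (‖Π − 1‖ ≤ e^{2r(d+1)} − 1 ≤ 2(d+1)e^{d+1}·r)
  have hexpr : Real.exp (2 * r * ((d : ℝ) + 1)) - 1 ≤ 2 * ((d : ℝ) + 1) * Real.exp ((d : ℝ) + 1) * r := by
    have hx0 : 0 ≤ 2 * r * ((d : ℝ) + 1) := by positivity
    have hx1 : 2 * r * ((d : ℝ) + 1) ≤ (d : ℝ) + 1 := by
      calc 2 * r * ((d : ℝ) + 1) ≤ 1 * ((d : ℝ) + 1) := mul_le_mul_of_nonneg_right hr2 hd0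
        _ = (d : ℝ) + 1 := one_mul _
    have hmv : ∀ x : ℝ, Real.exp x - 1 ≤ x * Real.exp x := fun x => by
      have h1 := Real.add_one_le_exp (-x)
      have hpos := Real.exp_pos x
      have hmul : Real.exp (-x) * Real.exp x = 1 := by rw [← Real.exp_add]; simp
      have h2 : (-x + 1) * Real.exp x ≤ Real.exp (-x) * Real.exp x := mul_le_mul_of_nonneg_right h1 hpos.le
      have h3 : (-x + 1) * Real.exp x = Real.exp x - x * Real.exp x := by ring
      rw [hmul, h3] at h2
      linarith
    calc Real.exp (2 * r * ((d : ℝ) + 1)) - 1 ≤ 2 * r * ((d : ℝ) + 1) * Real.exp (2 * r * ((d : ℝ) + 1)) := hmv _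
      _ ≤ 2 * r * ((d : ℝ) + 1) * Real.exp ((d : ℝ) + 1) := mul_le_mul_of_nonneg_left (Real.exp_le_exp.2 hx1) hx0
      _ = 2 * ((d : ℝ) + 1) * Real.exp ((d : ℝ) + 1) * r := by ring
  have hkerC : ∀ p, ‖expKerC L j A' p‖ ≤ 2 * ((d : ℝ) + 1) * Real.exp ((d : ℝ) + 1) * r := fun p => by
    have hXc : ∀ μ b, ‖((L ^ j.m : ℕ) : ℝ) • expXc L j A' μ b‖ ≤ ((L ^ j.m : ℕ) : ℝ) * (ηf * (2 * r)) := fun μ b => by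
      rw [norm_smul, Real.norm_eq_abs, abs_of_nonneg (Nat.cast_nonneg _)]
      exact mul_le_mul_of_nonneg_left (hXtle μ b) (Nat.cast_nonneg _)
    have h := norm_lineProd_sub_one_le (L ^ j.k) j.Mn (mul_nonneg (Nat.cast_nonneg _) hρ0) hXc p
    have heq : ((L ^ j.m : ℕ) : ℝ) * (ηf * (2 * r)) * (L ^ j.k : ℕ) * ((d : ℝ) + 1) = 2 * r * ((d : ℝ) + 1) := by
      have : ((L ^ j.m : ℕ) : ℝ) * ηf * (L ^ j.k : ℕ) = 1 := by rw [← hnf]; push_cast; ring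
      calc ((L ^ j.m : ℕ) : ℝ) * (ηf * (2 * r)) * (L ^ j.k : ℕ) * ((d : ℝ) + 1) = (((L ^ j.m : ℕ) : ℝ) * ηf * (L ^ j.k : ℕ)) * (2 * r * ((d : ℝ) + 1)) := by ring
        _ = _ := by rw [this, one_mul]
    rw [heq] at h
    unfold expKerC; exact h.trans hexpr
  have hkerF : ∀ p', ‖expKerF L j A' p'‖ ≤ 2 * ((d : ℝ) + 1) * Real.exp ((d : ℝ) + 1) * r := fun p' => by
    have h := norm_lineProd_sub_one_le (L ^ j.m * L ^ j.k) j.Mn hρ0 hX'le p'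
    have heq : ηf * (2 * r) * (L ^ j.m * L ^ j.k : ℕ) * ((d : ℝ) + 1) = 2 * r * ((d : ℝ) + 1) := by
      calc ηf * (2 * r) * (L ^ j.m * L ^ j.k : ℕ) * ((d : ℝ) + 1) = (((L ^ j.m * L ^ j.k : ℕ) : ℝ) * ηf) * (2 * r * ((d : ℝ) + 1)) := by ring
        _ = _ := by rw [hnf, one_mul]
    rw [heq] at h
    unfold expKerF; exact h.trans hexpr
  -- the kernels: the two-spacing fit
  have hkerD : ∀ p', ‖expKerF L j A' p' - expKerC L j A' (kingPrV L j.k j.m j.Mn p')‖ ≤ expCF d 1 * r * thetaV L j := fun p' => by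
    have hls := norm_lineProd_two_spacing_le L j.k j.m j.Mn (𝔸 := 𝔄 →L[ℝ] 𝔄) hρ0 (by positivity : (0:ℝ) ≤ ηf * (2 * (Cπ * (r * ηf)))) hρn hX'le hXtle hXfit p'
    have hid : expKerF L j A' p' - expKerC L j A' (kingPrV L j.k j.m j.Mn p') =
        lineProd (L ^ j.m * L ^ j.k) j.Mn (expXf L j A') p' - lineProd (L ^ j.k) j.Mn (fun μ b => ((L ^ j.m : ℕ) : ℝ) • expXc L j A' μ b)
          (kingPrV L j.k j.m j.Mn p') := by
      unfold expKerF expKerC; exact sub_sub_sub_cancel_right _ _ _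
    rw [hid]
    refine hls.trans ?_
    -- `36·n′·ω = 72·C_πη′·r ≤ 144(d+1)θ r`, `9·L^m·ρ = 18·ηc·r ≤ 18 θ r`
    have e1 : 36 * ((L ^ j.m * L ^ j.k : ℕ) : ℝ) * (ηf * (2 * (Cπ * (r * ηf)))) = 72 * (Cπ * ηf) * r := by
      calc 36 * ((L ^ j.m * L ^ j.k : ℕ) : ℝ) * (ηf * (2 * (Cπ * (r * ηf)))) = 72 * (((L ^ j.m * L ^ j.k : ℕ) : ℝ) * ηf) * (Cπ * ηf) * r := by ring
        _ = _ := by rw [hnf]; ring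
    have e2 : 9 * (((L ^ j.m : ℕ) : ℝ) * (ηf * (2 * r))) = 18 * ηc * r := by rw [hηcf]; ring
    rw [e1, e2]
    have h3 : 72 * (Cπ * ηf) * r ≤ 72 * (2 * ((d : ℝ) + 1) * thetaV L j) * r :=
      mul_le_mul_of_nonneg_right (mul_le_mul_of_nonneg_left hCθ (by norm_num)) hr0
    have h4 : 18 * ηc * r ≤ 18 * thetaV L j * r := mul_le_mul_of_nonneg_right (mul_le_mul_of_nonneg_left hηθ (by norm_num)) hr0
    have h34 := add_le_add h3 h4
    have hp3 : (0 : ℝ) ≤ 3 ^ (d + 1) := by positivity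
    calc (3 : ℝ) ^ (d + 1) * (((d : ℝ) + 1) * (72 * (Cπ * ηf) * r + 18 * ηc * r))
        ≤ 3 ^ (d + 1) * (((d : ℝ) + 1) * (72 * (2 * ((d : ℝ) + 1) * thetaV L j) * r + 18 * thetaV L j * r)) :=
          mul_le_mul_of_nonneg_left (mul_le_mul_of_nonneg_left h34 hd0) hp3
      _ = expCF d 1 * r * thetaV L j := by unfold expCF; ring
  -- the multipliers' letters in coordinates
  have hrow : ∀ (p : Tor (fine (L ^ j.k) j.Mn) × Fin (d + 1)) i, ∑ j', |coordMat e (expKerC L j A' p) i j'| ≤ expCF d (basisConst e) * r := fun p i =>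
    (rowBound_of_opNormBound e hkerC p i).trans (by
      have : basisConst e * (2 * ((d : ℝ) + 1) * Real.exp ((d : ℝ) + 1) * r) = (2 * ((d : ℝ) + 1) * Real.exp ((d : ℝ) + 1) * basisConst e) * r := by ring
      rw [this]; exact mul_le_mul_of_nonneg_right hcF1 hr0)
  have hrow' : ∀ (p' : Tor (fine (L ^ j.m * L ^ j.k) j.Mn) × Fin (d + 1)) i, ∑ j', |coordMat e (expKerF L j A' p') i j'| ≤ expCF d (basisConst e) * r :=
    fun p' i => (rowBound_of_opNormBound e hkerF p' i).trans (by
      have : basisConst e * (2 * ((d : ℝ) + 1) * Real.exp ((d : ℝ) + 1) * r) = (2 * ((d : ℝ) + 1) * Real.exp ((d : ℝ) + 1) * basisConst e) * r := by ring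
      rw [this]; exact mul_le_mul_of_nonneg_right hcF1 hr0)
  have hMc := hasMaj_mmulOp (g := unitTorusGeoS L j.k j.Mn j.Msz) (ι := ι) (blkFine L j.k j.Mn) (m := fun _ => expCF d (basisConst e) * r)
    (fun _ => mul_nonneg hcF0 hr0) (fun p i => hrow p i)
  have hMf := hasMaj_mmulOp (g := unitTorusGeoS L j.k j.Mn j.Msz) (ι := ι) (blkFine L j.k j.Mn ∘ kingPrV L j.k j.m j.Mn)
    (m := fun _ => expCF d (basisConst e) * r) (fun _ => mul_nonneg hcF0 hr0) (fun p' i => hrow' p' i)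
  have hMD := hasMaj_idef_mmulOp_of_opNormFit (g := unitTorusGeoS L j.k j.Mn j.Msz) (ι := ι) e (blkFine L j.k j.Mn) (kingPrV L j.k j.m j.Mn)
    (C' := expKerF L j A') (C := expKerC L j A') (o := fun _ => expCF d 1 * r * thetaV L j)
    (fun _ => mul_nonneg (mul_nonneg (expCF_nonneg_le (d := d) zero_le_one).1 hr0) hθ0) (fun p' => hkerD p')
  have hMD' : HasMaj (BlockNorm.ofBlocks (unitTorusGeoS L j.k j.Mn j.Msz) (liftBlk (blkFine L j.k j.Mn) ι))
      (BlockNorm.ofBlocks (unitTorusGeoS L j.k j.Mn j.Msz) (liftBlk (blkFine L j.k j.Mn) ι ∘ liftMap (kingPrV L j.k j.m j.Mn) ι))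
      (idef (pull (liftMap (kingPrV L j.k j.m j.Mn) ι)) (pull (liftMap (kingPrV L j.k j.m j.Mn) ι)) (mmulOp fun p' => coordMat e (expKerF L j A' p'))
        (mmulOp fun p => coordMat e (expKerC L j A' p))) (diagK fun _ => expCF d (basisConst e) * r * thetaV L j) :=
    hMD.mono fun y y' => diagK_mono (fun _ => le_of_eq (by unfold expCF; ring)) y y'
  -- through `Q` (uniform fibres)
  have hq : ∀ p : (Tor (fine (L ^ j.k) j.Mn) × Fin (d + 1)) × ι,
      liftBlk (blkFine L j.k j.Mn) ι p = liftBlk (fun b : Tor j.Mn × Fin (d + 1) => b.1) ι (liftMap (qbond L j.k j.Mn) ι p) := fun _ => rfl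
  obtain ⟨hc1, hc2⟩ := hasMaj_fibAvg_comp (g := unitTorusGeoS L j.k j.Mn j.Msz) (liftBlk (blkFine L j.k j.Mn) ι)
    (liftBlk (fun b : Tor j.Mn × Fin (d + 1) => b.1) ι) (liftMap (qbond L j.k j.Mn) ι) hq (mul_nonneg hcF0 hr0) hMc
  obtain ⟨hf1, hf2⟩ := hasMaj_fibAvg_comp (g := unitTorusGeoS L j.k j.Mn j.Msz) (liftBlk (blkFine L j.k j.Mn) ι ∘ liftMap (kingPrV L j.k j.m j.Mn) ι)
    (liftBlk (fun b : Tor j.Mn × Fin (d + 1) => b.1) ι) (liftMap (qbond L j.k j.Mn) ι ∘ liftMap (kingPrV L j.k j.m j.Mn) ι) (fun p => hq _)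
    (mul_nonneg hcF0 hr0) hMf
  obtain ⟨hd1', hd2'⟩ := hasMaj_idef_fibAvg_comp (g := unitTorusGeoS L j.k j.Mn j.Msz) (liftBlk (blkFine L j.k j.Mn) ι)
    (liftBlk (fun b : Tor j.Mn × Fin (d + 1) => b.1) ι) (liftMap (qbond L j.k j.Mn) ι) (liftMap (kingPrV L j.k j.m j.Mn) ι) hq
    (pow_ne_zero _ (pow_ne_zero _ hL0)) (card_fibre_kingPrV_lift L j.k j.m j.Mn ι) (mul_nonneg (mul_nonneg hcF0 hr0) hθ0) hMD'
  exact ⟨hc1, hc2, hf1, hf2, hd1', hd2'⟩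

end Species

/-! ## §2 The knit with the parallel-transport species: no species letter displayed -/

section Knit

variable {𝔄 : Type} [NormedRing 𝔄] [NormedAlgebra ℝ 𝔄] [CompleteSpace 𝔄] {ι : Type} [Fintype ι] [DecidableEq ι] (e : 𝔄 ≃L[ℝ] (ι → ℝ)) {L : ℕ} [NeZero L]
  (a : ℝ)

/-- **NE2⁺, OPERATOR LAYER — `T4EtaRate.NE2PlusOperator` BY NAME FOR THE U = 1 VECTOR PIECE ⊗ 1_𝔤 DRESSED BY THE (3.60)-SHAPED FULL PERTURBATION WITH THE
PARALLEL-TRANSPORT SPECIES** `F₂(A′) = Q∘M_{Π_Γ exp(η ad Ā) − 1}`, `F₂*(A′) = M_{…}∘Q*` (fine: `η′`, `A′`): `d + 1 ≥ 2`, `L ≥ 1`, every `c₃₅ > 0`, every (3.24) weight `a` —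
`ne2PlusOperator_vectorPiece_vWordsG` with ALL SIX species letters DISCHARGED by `expF_letters` (`c_F = 3^{d+1}(d+1)(144(d+1)+18)κ_e`).
[cite: Balaban1985BackgroundPropagators, Thm 3.1 p.397 (quantifier template), (3.35)–(3.36) p.396, (3.42) p.397, (3.52) p.400, (3.57)–(3.65) pp.401–403 (shapes, mechanism); King1986, (4.42)–(4.43) p.675, p.664] -/
theorem ne2PlusOperator_vectorPiece_vWordsExp (hd : 1 ≤ d) (hL : 1 ≤ L) (c35 : ℝ) (hc35 : 0 < c35) :
    NE2PlusOperator c35 (v1GVecInstance (d := d) 𝔄 ι L hL)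
      (vWGVecFamily4 (d := d) 𝔄 ι e L a hL (expFc ι e L) (expFsc ι e L) (expFf ι e L) (expFsf ι e L)) :=
  ne2PlusOperator_vectorPiece_vWordsG (d := d) e a hd hL c35 hc35 (expCF_nonneg_le (d := d) (basisConst_nonneg e)).1 (expFc ι e L) (expFsc ι e L)
    (expFf ι e L) (expFsf ι e L) fun j _ _ hα₀ hsm hreg => expF_letters (d := d) e hL j hc35 hα₀ hsm hreg

/-- The four-dimensional instance (`d + 1 = 4`). [cite: Balaban1985BackgroundPropagators, Thm 3.1 p.397 (quantifier template)] -/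
theorem ne2PlusOperator_vectorPiece_vWordsExp_dim4 (hL : 1 ≤ L) (c35 : ℝ) (hc35 : 0 < c35) :
    NE2PlusOperator c35 (v1GVecInstance (d := 3) 𝔄 ι L hL)
      (vWGVecFamily4 (d := 3) 𝔄 ι e L a hL (expFc ι e L) (expFsc ι e L) (expFf ι e L) (expFsf ι e L)) :=
  ne2PlusOperator_vectorPiece_vWordsExp (d := 3) e a (by norm_num) hL c35 hc35

/-- **NE2⁰ FOR THE SAME FAMILY** (`T4EtaRate.ne2Zero_of_ne2Plus` at `c₃₅ = 1`). [cite: King1986, Props. 3.8–3.9 (3.71)–(3.75) pp.664–665 (A = 0 model)] -/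
theorem ne2ZeroOperator_vectorPiece_vWordsExp (hd : 1 ≤ d) (hL : 1 ≤ L) :
    NE2ZeroOperator (v1GVecInstance (d := d) 𝔄 ι L hL)
      (vWGVecFamily4 (d := d) 𝔄 ι e L a hL (expFc ι e L) (expFsc ι e L) (expFf ι e L) (expFsf ι e L)) :=
  ne2ZeroOperator_vectorPiece_vWordsG (d := d) e a hd hL (expCF_nonneg_le (d := d) (basisConst_nonneg e)).1 (expFc ι e L) (expFsc ι e L)
    (expFf ι e L) (expFsf ι e L) fun j _ _ hα₀ hsm hreg => expF_letters (d := d) e hL j one_pos hα₀ hsm hreg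

end Knit

end Summit.QuantumFields.YangMills.BalabanUVNodes.N15.VectorPiece

end
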